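import Literature.Barriers.ValiantsHypothesis.RankMethods
import Literature.Computability.AlgebraicComplexity.RankMethodBarriersProofs
import Literature.Computability.AlgebraicComplexity.RankMethodBarriersWaring
import HarnessLib

/-!
# Barrier catalogue `ValiantsHypothesis`: the rank-method barrier is a theorem

Discharge of the barrier fact `RankMethods` (`RankMethods.lean`:
`RankMethods := EGOW2018_thm11 ∧ EGOW2018_thm12`, Efremenko–Garg–Oliveira–Wigderson 2018,
Thm. 1.1 and Thm. 1.2) from the proofs of Theorem 4.4 (`EGOW2018_thm44_holds`,
`RankMethodBarriersProofs.lean`, via the apolarity bound on the Segre chart) and Theorem 4.2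
(`EGOW2018_thm42_holds`, `RankMethodBarriersWaring.lean`) via Cor. 4.5 / Cor. 4.3
(`rankMethods_of_thm44_thm42`). With it the no-go consequences of `RankMethods.lean` become
unconditional (`not_tensorRankMethodProves`, `not_waringRankMethodProves`,
`not_tensorRankMethodProves_pow`).

The proof of Theorem 4.2 (files `SymbolicMatrixMinors`, `SymbolicMatrixDecomposition`,
`CoefficientSpaceRank`, `RankMethodBarriersWaring` under
`Literature/Computability/AlgebraicComplexity/`) follows the paper: maximal non-vanishing minor and
adjugate factorization in place of the symbolic rank over `F(x)` (Lemma 2.7), translation and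
truncated geometric series (Lemma 3.2), weighted-homogeneous components (Lemmas 3.3, 3.5),
coefficient spaces (§2.3), and the spanning of `F[x]_{≤ d}` by `d`-th powers of affine forms; the
same engine (`rank_sum_smul_eval_le_of_weighted`) also yields Theorem 4.4, which the tree proves
independently in `RankMethodBarriersProofs.lean`.

## References

* [EfremenkoGargOliveiraWigderson2018] K. Efremenko, A. Garg, R. Oliveira, A. Wigderson,
  *Barriers for rank methods in arithmetic complexity*, ITCS 2018; arXiv:1710.09502, Thm. 1.1,
  Thm. 1.2, Thm. 4.2, Cor. 4.3, Thm. 4.4, Cor. 4.5.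
-/

noncomputable section

namespace Literature.Barriers.ValiantsHypothesis

open Literature.Computability.AlgebraicComplexity

/-- **The rank-method barrier holds** (EGOW 2018, Thm. 1.1 ∧ Thm. 1.2): discharge of the barrier
fact `RankMethods`. [cite: EfremenkoGargOliveiraWigderson2018, Thm. 1.1 and Thm. 1.2] -/
theorem RankMethods_holds : RankMethods :=
  rankMethods_of_thm44_thm42 EGOW2018_thm44_holds EGOW2018_thm42_holds

/-- Unconditional form of `RankMethods.not_tensorRankMethodProves`: no rank method certifies tensor
rank above `2^d · n^{⌊d/2⌋}` for any `d`-tensor of side `n ≥ 1` over an algebraically closed field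
of characteristic zero. [cite: EfremenkoGargOliveiraWigderson2018, Thm. 1.1] -/
theorem not_tensorRankMethodProves (F : Type) [Field F] [IsAlgClosed F] [CharZero F] {n : ℕ}
    (hn : 0 < n) (d : ℕ) (T : (Fin d → Fin n) → F) :
    ¬ TensorRankMethodProves F n d (2 ^ d * n ^ (d / 2)) T :=
  RankMethods_holds.not_tensorRankMethodProves F hn d T

/-- Unconditional form of `RankMethods.not_waringRankMethodProves`: no rank method certifies
Waring rank above `(d+1) · C(n+⌊d/2⌋, n)` for any polynomial of degree `≤ d` in `n ≥ 1` variables.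
[cite: EfremenkoGargOliveiraWigderson2018, Thm. 1.2] -/
theorem not_waringRankMethodProves (F : Type) [Field F] [IsAlgClosed F] [CharZero F] {n : ℕ}
    (hn : 0 < n) (d : ℕ) {f : MvPolynomial (Fin n) F} (hf : f.totalDegree ≤ d) :
    ¬ WaringRankMethodProves F n d ((d + 1) * Nat.choose (n + d / 2) n) f :=
  RankMethods_holds.not_waringRankMethodProves F hn d hf

/-- Unconditional form of `RankMethods.not_tensorRankMethodProves_pow`: for `n ≥ 16` no rank method
certifies tensor rank above `n^{⌈3d/4⌉}` — bounded away in the exponent from the `n^{d(1-o(1))}`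
required by Raz's route to formula lower bounds. [cite: EfremenkoGargOliveiraWigderson2018, Thm. 1.1 and §1.1] -/
theorem not_tensorRankMethodProves_pow (F : Type) [Field F] [IsAlgClosed F] [CharZero F] {n : ℕ}
    (hn : 16 ≤ n) (d : ℕ) (T : (Fin d → Fin n) → F) :
    ¬ TensorRankMethodProves F n d (n ^ ((3 * d + 3) / 4)) T :=
  RankMethods_holds.not_tensorRankMethodProves_pow F hn d T

end Literature.Barriers.ValiantsHypothesis
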